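import Summits.BirchSwinnertonDyer.BirchSwinnertonDyer.Theorems.GenusKolyvaginAtTwoShaCardDvdPowAtTwoRTOnCut
import HarnessLib

/-!
# Route `GenusKolyvaginAtTwo`, crux U_T `ShaCardDvdPowAtTwoRT` (rev 39, stmt-BirchSwinnertonDyer-23469) — CLOSED BY NAME

Seat `bsd-line-gk2-p1` g19 (LEAD, cell `bsd-f1-sign2`), `--workitem stmt-BirchSwinnertonDyer-23469`.  THEOREMS ONLY (no definition, no named fact,
no `sorry`).  Rev 39 (route pen bsd-idea-1 g21, R7-d) restated U_T ONTO THE LIVE CONFIGURATION with the text of this seat's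
`RationalPairDescent.shaCardDvdPowAtTwoRT_onCut` (`…RTOnCut`, p750958) VERBATIM: U_T's rev-37 frame through `hndiv`, then `W.rootNumber = 1`, a
globally minimal elliptic model `Wd ≅ E^{(d_K)}`, `#Sel₂(Wd) = 2`, `ord₂ c(Wd) ≤ 1` ⊢ `#Ш(E/K)[2^∞] ∣ 2^(2M₀)`.  So the crux is LINE 19
`rational_pair_descent` assembled: PAIRCOUNT (gk2-p4 g22 `stub_shaRatCardDvdOfMinimalTwin`, p749270: Kolyvagin's B₂ at 2 over `ℚ` + the 2-descent
rank comparison + the Cassels–Tate count) × SANDWICH′ (this seat `stub_sandwichOfMinimalTwin`, p750599: invariant classes are restrictions, the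
Kramer class, the sign rule for the twist on `H¹(K,·)`, the twin's relaxed genus group) × `#Ш(E/K)[2^∞] = 4^t` (gk2-p5 g29).
UNCONDITIONAL modulo the in-signature antecedent Q2 `KolyvaginRelationAtTwo` (Q5R and the Q1-shape clause are idle).
**BSD is NOT proved by this**; rung K4 `NonCMAtTwo` is NOT proved by this (the route's other cruxes — the supply `GenusDeepSupplyAtTwoNegDisc`,
Q3R_T's re-glue — remain); nothing beyond U_T (rev 39) is closed here.

References: [McCallumLMS1991] §5 Thm. 5.4, Cor. 5.6; [Kramer1981] Thm. 1; [GrossLMS1991] §5 (5.1)–(5.3); [Kolyvagin1989Izv] Thm. B₂; [Kolyvagin1990] Thm. A.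
-/

set_option autoImplicit false
-- the Theorems namespace of this sub repeats the summit name by design (D-0017 nested layout)
set_option linter.dupNamespace false

noncomputable section

namespace Summit.BirchSwinnertonDyer.BirchSwinnertonDyer.Theorems

open Summit.BirchSwinnertonDyer.BirchSwinnertonDyer.Theses.GenusKolyvaginAtTwo

/-- **U_T `ShaCardDvdPowAtTwoRT` (rev 39) holds**: on the (D-NPh)/(β″) habitat with `w(E) = 1` and a 2-Selmer-minimal globally minimal twin model
`Wd ≅ E^{(d_K)}` with `ord₂ c(Wd) ≤ 1`, `#Ш(E/K)[2^∞] ∣ 2^(2M₀)` — LINE 19's `shaCardDvdPowAtTwoRT_onCut` by name (the route decl unfolds to its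
statement verbatim).  BSD is NOT proved by this.  [cite: McCallumLMS1991, §5 Thm. 5.4, Cor. 5.6] [cite: Kramer1981, Thm. 1] [cite: GrossLMS1991, §5] -/
theorem shaCardDvdPowAtTwoRT_proof : ShaCardDvdPowAtTwoRT := by
  unfold ShaCardDvdPowAtTwoRT
  exact GenusExact.RationalPairDescent.shaCardDvdPowAtTwoRT_onCut

end Summit.BirchSwinnertonDyer.BirchSwinnertonDyer.Theorems

end
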